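import Literature.Geometry.Lorentzian.StationaryOrbitRelation
import HarnessLib

/-!
# The orbit space `S = M/G` of a stationary space-time (Anderson 2000, §0)

M. T. Anderson, *On stationary vacuum solutions to the Einstein equations*, Ann. Henri Poincaré 1
(2000), §0: "Let `S` be the orbit space of the action `G` [the one-parameter group `G ≈ ℝ` of
isometries generated by the stationary Killing field `X`]. Then `S` is a smooth 3-manifold and the
projection `π : M → S` is a principle `ℝ`-bundle, with fiber `G`. The chronology condition implies
that `S` is Hausdorff and paracompact, c.f. [Ha]." This file introduces the orbit space as a
**topological space** and proves the topological part of this sentence, for the orbits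
`stationaryOrbit X {p}` (`Stationary.lean`) of a vector field `X` on a manifold `M`:

* `orbitSetoid X` — the equivalence relation generated by "`q` lies on the orbit of `p`"
  (`q ∈ stationaryOrbit X {p}`); for a complete `C¹` field on a Hausdorff manifold without boundary
  this relation is already an equivalence relation
  (`IsCompleteVectorField.equivalence_mem_stationaryOrbit`, `CompleteStationaryVacuumFlatProofs.lean`),
  and `orbitProj_eq_iff` recovers it: `π p = π q ↔ q ∈ stationaryOrbit X {p}`;
* `OrbitSpace X := Quotient (orbitSetoid X)` — **the orbit space `S = M/G`** with the quotient
  topology, and `orbitProj X : M → OrbitSpace X` — **the projection `π`**;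
* `preimage_image_orbitProj` (`π⁻¹(π(A)) = ⋃ₛ φₛ(A)`), `orbitProj_preimage_singleton` (the fibres
  of `π` are the orbits — "with fiber `G`"), `isOpenMap_orbitProj`, `isOpenQuotientMap_orbitProj`
  (`π` is an open quotient map: saturations of open sets are open, `StationaryOrbitRelation.lean`),
  `secondCountableTopology_orbitSpace`, `connectedSpace_orbitSpace`;
* `LorentzianMetric.IsStationaryKilling.t2Space_orbitSpace` — **"the chronology condition implies
  that `S` is Hausdorff"**: for a time-oriented Lorentzian manifold (Hausdorff, without boundary,
  `C^n` metric with `n ≥ 2`) with a complete Killing field timelike at every point and no closed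
  timelike curves, `OrbitSpace X` is a `T2Space` — Mathlib's `t2Space_iff_of_isOpenQuotientMap`
  applied to the closedness of the orbit relation
  (`IsStationaryKilling.isClosed_setOf_mem_stationaryOrbit`, `StationaryOrbitRelation.lean`, whose
  module docstring spells out the argument Anderson cites from [Ha] = Harris 1992);
  `Spacetime.IsStationaryKilling.t2Space_orbitSpace` is the bundled four-dimensional form under the
  hypotheses of `Anderson2000_completeStationaryVacuumFlat`.

Not here: the smooth structure of `S` (a `3`-manifold, charts from flow boxes), the bundle
structure of `π` and the quotient metric `g_S` — Anderson's orbit data `(S, g_S, u, θ)`.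

## Design

The setoid is `Relation.EqvGen.setoid` of the orbit relation, so that `orbitSetoid`, `OrbitSpace`
and `orbitProj` are defined for every vector field with no hypotheses (Mathlib's
`MulAction.orbitRel` is not available: the flow of `X` is not a registered action); all topological
statements then assume what they need (`C¹`, complete, Hausdorff, boundaryless). `OrbitSpace` is an
`abbrev` for a `Quotient`, so the quotient topology and `Quotient.instConnectedSpace` apply.

## References

* M. T. Anderson, Ann. Henri Poincaré 1 (2000) 977–994, arXiv:gr-qc/0001091, §0 (key
  `Anderson2000`).
* S. Harris, *Conformally stationary spacetimes*, Class. Quantum Grav. 9 (1992) 1823–1827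
  (Anderson's [Ha]).
* B. O'Neill, *Semi-Riemannian geometry*, Academic Press 1983, Ch. 9 (flows of Killing fields)
  (key `ONeill1983`).
-/

noncomputable section

open Bundle Set Filter Function Manifold TopologicalSpace Relation Topology
open scoped ContDiff Topology Manifold

namespace Literature.Geometry.Lorentzian

universe u

variable {E : Type*} [NormedAddCommGroup E] [NormedSpace ℝ E] {H : Type*} [TopologicalSpace H]
  {I : ModelWithCorners ℝ E H} {M : Type*} [TopologicalSpace M] [ChartedSpace H M]
  [IsManifold I ∞ M] {n : ℕ∞ω}

/-! ### The orbit space and the projection -/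

section Defs

variable (X : Π x : M, TangentSpace I x)

omit [IsManifold I ∞ M] in
/-- The **orbit equivalence relation** of the vector field `X`: the equivalence relation on `M`
generated by "`q` lies on the orbit `stationaryOrbit X {p}` of `p`" (for a complete `C¹` field on a
Hausdorff manifold without boundary this relation is itself an equivalence relation,
`orbitProj_eq_iff`). Its classes are the orbits of the group `G ≈ ℝ` generated by `X`
(Anderson 2000, §0: "Let `S` be the orbit space of the action `G`"). [cite: Anderson2000, §0] -/
def orbitSetoid : Setoid M :=
  EqvGen.setoid fun p q : M ↦ q ∈ stationaryOrbit X {p}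

omit [IsManifold I ∞ M] in
/-- The **orbit space `S = M/G`** of the vector field `X` (the quotient of `M` by `orbitSetoid X`),
with the quotient topology. Anderson 2000, §0 ("the orbit space of the action `G`").
[cite: Anderson2000, §0] -/
abbrev OrbitSpace : Type _ :=
  Quotient (orbitSetoid X)

omit [IsManifold I ∞ M] in
/-- The **projection `π : M → S`** onto the orbit space. Anderson 2000, §0.
[cite: Anderson2000, §0] -/
def orbitProj : M → OrbitSpace X :=
  Quotient.mk (orbitSetoid X)

omit [IsManifold I ∞ M] in
/-- Points on a common orbit have the same projection (no hypotheses: the setoid is generated by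
the orbit relation). [folklore] -/
theorem orbitProj_eq_of_mem {p q : M} (h : q ∈ stationaryOrbit X {p}) :
    orbitProj X p = orbitProj X q :=
  Quotient.sound (EqvGen.rel _ _ h)

omit [IsManifold I ∞ M] in
/-- The projection `π : M → S` is surjective. [folklore] -/
theorem orbitProj_surjective : Surjective (orbitProj X) :=
  fun y ↦ Quotient.inductionOn y fun x ↦ ⟨x, rfl⟩

omit [IsManifold I ∞ M] in
/-- The projection `π : M → S` is continuous (quotient topology). [folklore] -/
theorem continuous_orbitProj : Continuous (orbitProj X) :=
  continuous_quotient_mk'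

omit [IsManifold I ∞ M] in
/-- The projection `π : M → S` is a quotient map. [folklore] -/
theorem isQuotientMap_orbitProj : IsQuotientMap (orbitProj X) :=
  isQuotientMap_quotient_mk'

omit [IsManifold I ∞ M] in
/-- The orbit space of a connected manifold is connected. [folklore] -/
theorem connectedSpace_orbitSpace [ConnectedSpace M] : ConnectedSpace (OrbitSpace X) :=
  inferInstance

end Defs

/-! ### Complete `C¹` fields: `π p = π q` iff `q ∈ G·p`; `π` is an open quotient map -/

section Complete

variable [T2Space M] [BoundarylessManifold I M] (X : Π x : M, TangentSpace I x)

/-- **The fibres of the setoid are the orbits.** For a complete `C¹` vector field on a Hausdorff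
manifold without boundary, `π p = π q` iff `q` lies on the orbit of `p` (the orbit relation is an
equivalence relation, `IsCompleteVectorField.equivalence_mem_stationaryOrbit`, so it coincides
with the relation it generates, Mathlib's `Equivalence.eqvGen_iff`). Anderson 2000, §0.
[cite: Anderson2000, §0] -/
theorem orbitProj_eq_iff (hX : CMDiff 1 (T% X)) (hc : IsCompleteVectorField X) {p q : M} :
    orbitProj X p = orbitProj X q ↔ q ∈ stationaryOrbit X {p} := by
  rw [orbitProj, Quotient.eq]
  exact (hc.equivalence_mem_stationaryOrbit hX).eqvGen_iff

/-- **`π⁻¹(π(A))` is the orbit of `A`**: the saturation of a set under the projection is its orbit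
`⋃ₛ φₛ(A)` (`stationaryOrbit X A`). Anderson 2000, §0; Chruściel–Costa's `M_ext = ⋃ₜ φₜ(Σ_ext)`.
[cite: Anderson2000, §0] -/
theorem preimage_image_orbitProj (hX : CMDiff 1 (T% X)) (hc : IsCompleteVectorField X)
    (A : Set M) : orbitProj X ⁻¹' (orbitProj X '' A) = stationaryOrbit X A := by
  ext q
  simp only [mem_preimage, mem_image]
  constructor
  · rintro ⟨p, hp, hpq⟩
    exact stationaryOrbit_mono X (singleton_subset_iff.2 hp) ((orbitProj_eq_iff X hX hc).1 hpq)
  · rintro ⟨γ, hγ, h0, t, rfl⟩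
    exact ⟨γ 0, h0, (orbitProj_eq_iff X hX hc).2 ⟨γ, hγ, rfl, t, rfl⟩⟩

/-- **The fibres of `π` are the orbits** ("a principle `ℝ`-bundle, with fiber `G`", Anderson 2000,
§0): `π⁻¹(π p) = stationaryOrbit X {p}`. [cite: Anderson2000, §0] -/
theorem orbitProj_preimage_singleton (hX : CMDiff 1 (T% X)) (hc : IsCompleteVectorField X)
    (p : M) : orbitProj X ⁻¹' {orbitProj X p} = stationaryOrbit X {p} := by
  rw [← image_singleton, preimage_image_orbitProj X hX hc]

variable [CompleteSpace E]

/-- **The projection `π : M → S` is open**: the saturation `π⁻¹(π(U)) = ⋃ₜ θₜ(U)` of an open set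
is open (`isOpen_iUnion_image_flow`, the flow maps being homeomorphisms; the flow exists by
`Literature.Geometry.Manifold.exists_contMDiff_globalFlow_of_complete`). Anderson 2000, §0
(`π : M → S` is a bundle projection). [cite: Anderson2000, §0] -/
theorem isOpenMap_orbitProj (hX : CMDiff 1 (T% X)) (hc : IsCompleteVectorField X) :
    IsOpenMap (orbitProj X) := by
  intro U hU
  rw [← (isQuotientMap_orbitProj X).isOpen_preimage, preimage_image_orbitProj X hX hc]
  have hc' : ∀ x : M, ∃ γ : ℝ → M, γ 0 = x ∧ IsMIntegralCurve γ X := fun x ↦ by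
    obtain ⟨γ, hγ, h0⟩ := hc x
    exact ⟨γ, h0, hγ⟩
  have hX' : ContMDiff I I.tangent (1 : ℕ∞) (fun x ↦ (⟨x, X x⟩ : TangentBundle I M)) := by
    exact_mod_cast hX
  obtain ⟨θ, hθ, hθ0, hθadd, hθX⟩ :=
    Literature.Geometry.Manifold.exists_contMDiff_globalFlow_of_complete hX' le_rfl hc'
  rw [stationaryOrbit_eq_iUnion_image_flow hX hθX hθ0]
  exact isOpen_iUnion_image_flow hθ.continuous hθ0 hθadd hU

/-- **`π : M → S` is an open quotient map** (surjective, continuous, open). Anderson 2000, §0.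
[cite: Anderson2000, §0] -/
theorem isOpenQuotientMap_orbitProj (hX : CMDiff 1 (T% X)) (hc : IsCompleteVectorField X) :
    IsOpenQuotientMap (orbitProj X) :=
  ⟨orbitProj_surjective X, continuous_orbitProj X, isOpenMap_orbitProj X hX hc⟩

/-- **The orbit space is second countable** ("paracompact", Anderson 2000, §0): an open quotient
of a second countable space is second countable (Mathlib's `Quotient.secondCountableTopology`).
[cite: Anderson2000, §0] -/
theorem secondCountableTopology_orbitSpace [SecondCountableTopology M] (hX : CMDiff 1 (T% X))
    (hc : IsCompleteVectorField X) : SecondCountableTopology (OrbitSpace X) :=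
  Quotient.secondCountableTopology (isOpenMap_orbitProj X hX hc)

end Complete

/-! ### Chronology: the orbit space of a stationary space-time is Hausdorff -/

namespace LorentzianMetric

variable [FiniteDimensional ℝ E] [CompleteSpace E] [Fact (1 ≤ n)] [I.Boundaryless] [T2Space M]
  {g : LorentzianMetric I n M} [g.HasLeviCivita] {τ : TimeOrientation g}
  {X : Π x : M, TangentSpace I x}

/-- **"The chronology condition implies that `S` is Hausdorff"** (Anderson 2000, §0, citing
[Ha] = Harris 1992). For a `C^n` time-oriented Lorentzian metric, `n ≥ 2`, on a Hausdorff manifold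
without boundary, a complete Killing field `X` timelike and future-directed at every point, and
the chronology condition, the orbit space `OrbitSpace X = M/G` with the quotient topology is
Hausdorff: by Mathlib's `t2Space_iff_of_isOpenQuotientMap` for the open quotient map `π`
(`isOpenQuotientMap_orbitProj`) this is the closedness of `{(p, q) | π p = π q}`, i.e. of the orbit
relation, `IsStationaryKilling.isClosed_setOf_mem_stationaryOrbit`. [cite: Anderson2000, §0] -/
theorem IsStationaryKilling.t2Space_orbitSpace (h : g.IsStationaryKilling τ X univ)
    (hchr : g.IsChronological τ) (hn : 2 ≤ n) : T2Space (OrbitSpace X) := by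
  have hX1 : CMDiff 1 (T% X) := h.contMDiff_one
  rw [t2Space_iff_of_isOpenQuotientMap
    (isOpenQuotientMap_orbitProj X hX1 h.isCompleteVectorField)]
  have heq : {q : M × M | orbitProj X q.1 = orbitProj X q.2} =
      {pq : M × M | pq.2 ∈ stationaryOrbit X {pq.1}} := by
    ext pq
    exact orbitProj_eq_iff X hX1 h.isCompleteVectorField
  rw [heq]
  exact h.isClosed_setOf_mem_stationaryOrbit hchr hn

/-- **The orbit space of a chronological stationary space-time is a connected, second countable
Hausdorff space** (the topological content of Anderson 2000, §0: "`S` is a smooth 3-manifold … The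
chronology condition implies that `S` is Hausdorff and paracompact"), for a connected second
countable `M`. [cite: Anderson2000, §0] -/
theorem IsStationaryKilling.t2Space_and_secondCountable_orbitSpace [ConnectedSpace M]
    [SecondCountableTopology M] (h : g.IsStationaryKilling τ X univ) (hchr : g.IsChronological τ)
    (hn : 2 ≤ n) :
    T2Space (OrbitSpace X) ∧ SecondCountableTopology (OrbitSpace X) ∧
      ConnectedSpace (OrbitSpace X) :=
  ⟨h.t2Space_orbitSpace hchr hn,
    secondCountableTopology_orbitSpace X h.contMDiff_one h.isCompleteVectorField,
    connectedSpace_orbitSpace X⟩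

end LorentzianMetric

/-! ### The bundled form: Anderson's hypotheses -/

namespace Spacetime

variable {𝓢 : Spacetime.{u} 4} [𝓢.metric.HasLeviCivita]
  {X : Π x : 𝓢.carrier, TangentSpace (𝓡 4) x}

/-- `2 ≤ ∞` in `ℕ∞ω`. [folklore] -/
private lemma two_le_infty : (2 : ℕ∞ω) ≤ ∞ := WithTop.coe_le_coe.mpr le_top

/-- **Anderson 2000, §0, for a bundled spacetime: the orbit space is Hausdorff.** Under the
hypotheses of `Anderson2000_completeStationaryVacuumFlat` concerning the group action — a
four-dimensional chronological spacetime `𝓢` with a complete Killing field `X` timelike at every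
point — the orbit space `S = M/G` (`OrbitSpace X`, quotient topology) is a Hausdorff space.
[cite: Anderson2000, §0] -/
theorem IsStationaryKilling.t2Space_orbitSpace (hX : 𝓢.IsStationaryKilling X univ)
    (hchr : 𝓢.metric.IsChronological 𝓢.timeOrientation) : T2Space (OrbitSpace X) :=
  LorentzianMetric.IsStationaryKilling.t2Space_orbitSpace hX hchr two_le_infty

/-- **Anderson 2000, §0, for a bundled spacetime: `S` is a connected, second countable Hausdorff
space and `π : M → S` is an open quotient map whose fibres are the orbits.**
[cite: Anderson2000, §0] -/
theorem IsStationaryKilling.orbitSpace_topology (hX : 𝓢.IsStationaryKilling X univ)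
    (hchr : 𝓢.metric.IsChronological 𝓢.timeOrientation) :
    T2Space (OrbitSpace X) ∧ SecondCountableTopology (OrbitSpace X) ∧
      ConnectedSpace (OrbitSpace X) ∧ IsOpenQuotientMap (orbitProj X) ∧
      ∀ p : 𝓢.carrier, orbitProj X ⁻¹' {orbitProj X p} = 𝓢.stationaryOrbit X {p} :=
  ⟨hX.t2Space_orbitSpace hchr,
    secondCountableTopology_orbitSpace X hX.contMDiff_one hX.isCompleteVectorField,
    connectedSpace_orbitSpace X,
    isOpenQuotientMap_orbitProj X hX.contMDiff_one hX.isCompleteVectorField,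
    fun p ↦ orbitProj_preimage_singleton X hX.contMDiff_one hX.isCompleteVectorField p⟩

end Spacetime

end Literature.Geometry.Lorentzian

end
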